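import Summits.QuantumFields.YangMills.Theorems.AllWindowsColdBoxBoxHighLineTwoFormGauss
import Summits.QuantumFields.YangMills.Theorems.AllWindowsColdBoxBoxHighLineSmallFieldInsideFPByName
import Summits.QuantumFields.YangMills.Theorems.AllWindowsColdBoxBoxHighLineActionSandwichSharp
import Summits.QuantumFields.YangMills.Theorems.AllWindowsColdBoxBoxHighLineGhostLogRatio

/-!
# U5-L5 (iii) = T-S5.6′ `SmallFieldInsideFPSharp`, core: two-form domination of the FP weight and the two integral bounds
# (planner ym-idea-2 g18, `Cruxes/BoxWindowHighSU2213/TaskU5L5.lean`; LINE-20 U5 ⟨stmt-QuantumFields-24336⟩; U5 prep, helper-grade; U5 OPEN)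

Width seat `ym-line-sfw-p2-w4` (prover-ym-line-sfw-p2-w4-g29-0), T-S5.6 lineage.  The T-S5.6 cores (w4 g27 ✓`SmallFieldFP.setIntegral_diff_le` /
✓`le_setIntegral_smallField`) re-run with a TWO-FORM sandwich `|W + Φ − Q| ≤ δ·(Q + N)`, `N(a) = Σ_e ‖a_e‖²` (the shape of ✓6a′
`abs_action_sub_boxQuadForm_le_sharp`, w2 g32): `e^{−β((1+δ)Q + δN)} ≤ e^{−β(W+Φ)} ≤ e^{−β((1−δ)Q − δN)}`, so the comparison Gaussians are the two-form
Gaussians of ✓`…TwoFormGauss` (w4 g29) instead of `e^{−β(1∓ε)Q}`: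
* `fpChartWeight_le_of_lower` / `le_fpChartWeight_of_upper` — pointwise domination of `w_J = fpChartWeight β H r` from any lower/upper bound on `W + Φ`;
* `setIntegral_diff_le_sharp` (NUMERATOR): `∫_{chartDomain ∖ smallField s} w_J ≤ K·D₀·((2π²)⁻¹)^n·∫_{a ∉ smallField s} e^{−β((1−δ)Q − δN)}`;
* `le_setIntegral_smallField_sharp` (DENOMINATOR): `K⁻¹·D₀·((2π²)⁻¹)^n·e^{−n(t²/3+t⁴)}·∫_{smallField t} e^{−β((1+δ)Q + δN)} ≤ ∫_{smallField t} w_J`.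
The packaging (constants, ✓`ghostDetRatio_sq_le` h6b′, the bracket `C·H⁴·e^{C·r·H⁴(1+log H) − cβs²}`) is the companion file `…SmallFieldInsideFPSharp`.

Everything proved; no definitions; standard axioms.  HONEST LABEL: U5 prep, helper-grade (lift L5 of the NEXT rung U5 of a critic-PASSed DRAFT line); U5 ⟨24336⟩,
⟨24004⟩ and the seat's own crux ⟨22884⟩ remain OPEN; no stub is closed by name, no crux, rung or summit is proved; **the Yang–Mills mass gap is NOT proved by
this file; no summit is proved by a line.**
-/

set_option autoImplicit false

open MeasureTheory Real Finset

namespace Summit.QuantumFields.YangMills.Theorems.AllWindowsColdBoxBoxHighLine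

namespace SmallFieldFPSharp

open SmallFieldFP TwoFormGauss

variable {H : ℕ}

/-! ## Pointwise two-sided domination of the FP weight by functions of the field -/

/-- **UPPER bound** from a LOWER bound `L(a) ≤ W(a) + Φ(a)` on `smallField H t`: `w(a) ≤ |det F(U_a)|·((2π²)⁻¹)^n·e^{−β·L(a)}` (`β ≥ 0`). -/
theorem fpChartWeight_le_of_lower {β t : ℝ} (hβ : 0 ≤ β) {L : (LandauFree H → E3) → ℝ}
    (hlow : ∀ a : LandauFree H → E3, a ∈ smallField H t → L a ≤ boxWilson H (edgeChart H a) + landauPhi H (edgeChart H a))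
    (r : ℝ) {a : LandauFree H → E3} (ha : a ∈ smallField H t) :
    fpChartWeight β H r a ≤ |(fpOperator H (edgeChart H a)).det| * (1 / (2 * Real.pi ^ 2)) ^ Fintype.card (LandauFree H) *
      Real.exp (-(β * L a)) := by
  have h1 : ballCutoff H r (edgeChart H a) ≤ 1 := ballCutoff_le_one H r _
  have h0 : 0 ≤ ballCutoff H r (edgeChart H a) := ballCutoff_nonneg H r _
  have h2 : Real.exp (-(β * (boxWilson H (edgeChart H a) + landauPhi H (edgeChart H a)))) ≤ Real.exp (-(β * L a)) :=
    Real.exp_le_exp.2 (by nlinarith [mul_le_mul_of_nonneg_left (hlow a ha) hβ])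
  have h3 := ChartHaar.chartHaarWeight_le a
  have h3' := ChartHaar.chartHaarWeight_nonneg a
  unfold fpChartWeight
  have hA : ballCutoff H r (edgeChart H a) * Real.exp (-(β * (boxWilson H (edgeChart H a) + landauPhi H (edgeChart H a)))) ≤
      1 * Real.exp (-(β * L a)) := mul_le_mul h1 h2 (Real.exp_pos _).le zero_le_one
  have hB := mul_le_mul_of_nonneg_right hA (abs_nonneg ((fpOperator H (edgeChart H a)).det))
  have hC := mul_le_mul hB h3 h3' (mul_nonneg (mul_nonneg zero_le_one (Real.exp_pos _).le) (abs_nonneg _))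
  calc ballCutoff H r (edgeChart H a) * Real.exp (-(β * (boxWilson H (edgeChart H a) + landauPhi H (edgeChart H a)))) *
        |(fpOperator H (edgeChart H a)).det| * chartHaarWeight H a
      ≤ 1 * Real.exp (-(β * L a)) * |(fpOperator H (edgeChart H a)).det| * (1 / (2 * Real.pi ^ 2)) ^ Fintype.card (LandauFree H) := hC
    _ = |(fpOperator H (edgeChart H a)).det| * (1 / (2 * Real.pi ^ 2)) ^ Fintype.card (LandauFree H) * Real.exp (-(β * L a)) := by ring

/-- **LOWER bound** from an UPPER bound `W(a) + Φ(a) ≤ U(a)` on `smallField H t`, `0 ≤ t ≤ min(r, 1)`, `r ≠ 0`: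
`|det F(U_a)|·((2π²)⁻¹)^n·e^{−n(t²/3+t⁴)}·e^{−β·U(a)} ≤ w(a)`. -/
theorem le_fpChartWeight_of_upper {β t r : ℝ} (hβ : 0 ≤ β) (hr : r ≠ 0) (ht0 : 0 ≤ t) (htr : t ≤ r) (ht1 : t ≤ 1)
    {U : (LandauFree H → E3) → ℝ}
    (hup : ∀ a : LandauFree H → E3, a ∈ smallField H t → boxWilson H (edgeChart H a) + landauPhi H (edgeChart H a) ≤ U a)
    {a : LandauFree H → E3} (ha : a ∈ smallField H t) :
    |(fpOperator H (edgeChart H a)).det| * ((1 / (2 * Real.pi ^ 2)) ^ Fintype.card (LandauFree H) *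
        Real.exp (-(Fintype.card (LandauFree H) * (t ^ 2 / 3 + t ^ 4)))) * Real.exp (-(β * U a)) ≤ fpChartWeight β H r a := by
  have htπ : t ≤ Real.pi := ht1.trans (by linarith [Real.pi_gt_three])
  have hχ : ballCutoff H r (edgeChart H a) = 1 := FPChart.ballCutoff_edgeChart_eq_one hr ht0 htr htπ ha
  have h2 : Real.exp (-(β * U a)) ≤ Real.exp (-(β * (boxWilson H (edgeChart H a) + landauPhi H (edgeChart H a)))) :=
    Real.exp_le_exp.2 (by nlinarith [mul_le_mul_of_nonneg_left (hup a ha) hβ])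
  have h3 := ChartHaar.chartHaarWeight_ge_of_smallField ht1 ha
  have hlo : 0 ≤ (1 / (2 * Real.pi ^ 2)) ^ Fintype.card (LandauFree H) *
      Real.exp (-(Fintype.card (LandauFree H) * (t ^ 2 / 3 + t ^ 4))) := by positivity
  unfold fpChartWeight
  rw [hχ, one_mul]
  calc |(fpOperator H (edgeChart H a)).det| * ((1 / (2 * Real.pi ^ 2)) ^ Fintype.card (LandauFree H) *
          Real.exp (-(Fintype.card (LandauFree H) * (t ^ 2 / 3 + t ^ 4)))) * Real.exp (-(β * U a))
      = Real.exp (-(β * U a)) * |(fpOperator H (edgeChart H a)).det| *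
          ((1 / (2 * Real.pi ^ 2)) ^ Fintype.card (LandauFree H) * Real.exp (-(Fintype.card (LandauFree H) * (t ^ 2 / 3 + t ^ 4)))) := by ring
    _ ≤ Real.exp (-(β * (boxWilson H (edgeChart H a) + landauPhi H (edgeChart H a)))) * |(fpOperator H (edgeChart H a)).det| *
          chartHaarWeight H a :=
        mul_le_mul (mul_le_mul_of_nonneg_right h2 (abs_nonneg _)) h3 hlo (mul_nonneg (Real.exp_pos _).le (abs_nonneg _))

/-! ## The two integral bounds with the two-form Gaussians -/

/-- **NUMERATOR (sharp)**: with the sharp sandwich `|W + Φ − Q| ≤ δ·(Q + N)` and `|det F| ≤ K·D₀` on `smallField (πr)`: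
`∫_{chartDomain ∖ smallField s} w ≤ K·D₀·((2π²)⁻¹)^n · ∫_{a ∉ smallField s} e^{−β((1−δ)Q − δN)}`. -/
theorem setIntegral_diff_le_sharp (hH : 1 ≤ H) {β r s δ K D₀ : ℝ} (hβ : 0 < β) (hr : 0 ≤ r) (hδ0 : 0 ≤ δ) (hδ : 1376 * (H : ℝ) ^ 2 * δ ≤ 1)
    (hK : 0 ≤ K) (hD₀ : 0 ≤ D₀)
    (hsand : ∀ a : LandauFree H → E3, (∀ e, ‖a e‖ ≤ Real.pi * r) →
      |boxWilson H (edgeChart H a) + landauPhi H (edgeChart H a) - boxQuadForm H a| ≤ δ * (boxQuadForm H a + ∑ e, ‖a e‖ ^ 2))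
    (hdet : ∀ a : LandauFree H → E3, a ∈ smallField H (Real.pi * r) → |(fpOperator H (edgeChart H a)).det| ≤ K * D₀) :
    ∫ a in chartDomain H \ smallField H s, fpChartWeight β H r a ≤
      K * D₀ * (1 / (2 * Real.pi ^ 2)) ^ Fintype.card (LandauFree H) *
        ∫ a in (smallField H s)ᶜ, Real.exp (-(β * ((1 - δ) * boxQuadForm H a - δ * ∑ e, ‖a e‖ ^ 2))) := by
  have hpow : 0 ≤ (1 / (2 * Real.pi ^ 2)) ^ Fintype.card (LandauFree H) := by positivity
  have hM : 0 ≤ K * D₀ * (1 / (2 * Real.pi ^ 2)) ^ Fintype.card (LandauFree H) := mul_nonneg (mul_nonneg hK hD₀) hpow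
  have hS : MeasurableSet (chartDomain H \ smallField H s) := measurableSet_chartDomain.diff (ChartGauss.measurableSet_smallField s)
  have hlow : ∀ a : LandauFree H → E3, a ∈ smallField H (Real.pi * r) →
      (1 - δ) * boxQuadForm H a - δ * ∑ e, ‖a e‖ ^ 2 ≤ boxWilson H (edgeChart H a) + landauPhi H (edgeChart H a) := by
    intro a ha
    have h := (abs_le.1 (hsand a ha)).1
    linarith
  -- pointwise domination of the indicator
  have hptw : ∀ a : LandauFree H → E3, (chartDomain H \ smallField H s).indicator (fpChartWeight β H r) a ≤
      K * D₀ * (1 / (2 * Real.pi ^ 2)) ^ Fintype.card (LandauFree H) *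
        (smallField H s)ᶜ.indicator (fun a => Real.exp (-(β * ((1 - δ) * boxQuadForm H a - δ * ∑ e, ‖a e‖ ^ 2)))) a := by
    intro a
    by_cases ha : a ∈ chartDomain H \ smallField H s
    · have hac : a ∈ (smallField H s)ᶜ := ha.2
      rw [Set.indicator_of_mem ha, Set.indicator_of_mem hac]
      by_cases hb : a ∈ smallField H (Real.pi * r)
      · calc fpChartWeight β H r a ≤ |(fpOperator H (edgeChart H a)).det| * (1 / (2 * Real.pi ^ 2)) ^ Fintype.card (LandauFree H) *
              Real.exp (-(β * ((1 - δ) * boxQuadForm H a - δ * ∑ e, ‖a e‖ ^ 2))) := fpChartWeight_le_of_lower hβ.le hlow r hb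
          _ ≤ K * D₀ * (1 / (2 * Real.pi ^ 2)) ^ Fintype.card (LandauFree H) *
              Real.exp (-(β * ((1 - δ) * boxQuadForm H a - δ * ∑ e, ‖a e‖ ^ 2))) :=
              mul_le_mul_of_nonneg_right (mul_le_mul_of_nonneg_right (hdet a hb) hpow) (Real.exp_pos _).le
      · rw [EdgeChart.fpChartWeight_eq_zero_of_not_smallField β hr ha.1 hb]
        exact mul_nonneg hM (Real.exp_pos _).le
    · rw [Set.indicator_of_notMem ha]
      exact mul_nonneg hM (Set.indicator_nonneg (fun _ _ => (Real.exp_pos _).le) _)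
  have hgi := integrable_exp_twoFormMinus hH hβ hδ0 hδ
  have hupper : Integrable fun a : LandauFree H → E3 => K * D₀ * (1 / (2 * Real.pi ^ 2)) ^ Fintype.card (LandauFree H) *
      (smallField H s)ᶜ.indicator (fun a => Real.exp (-(β * ((1 - δ) * boxQuadForm H a - δ * ∑ e, ‖a e‖ ^ 2)))) a :=
    (hgi.indicator (ChartGauss.measurableSet_smallField s).compl).const_mul _
  rw [← integral_indicator hS]
  calc ∫ a, (chartDomain H \ smallField H s).indicator (fpChartWeight β H r) a
      ≤ ∫ a, K * D₀ * (1 / (2 * Real.pi ^ 2)) ^ Fintype.card (LandauFree H) *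
          (smallField H s)ᶜ.indicator (fun a => Real.exp (-(β * ((1 - δ) * boxQuadForm H a - δ * ∑ e, ‖a e‖ ^ 2)))) a :=
        integral_mono_of_nonneg (ae_of_all _ fun a => Set.indicator_nonneg (fun _ _ => FPChart.fpChartWeight_nonneg β r _) _)
          hupper (ae_of_all _ hptw)
    _ = K * D₀ * (1 / (2 * Real.pi ^ 2)) ^ Fintype.card (LandauFree H) *
          ∫ a in (smallField H s)ᶜ, Real.exp (-(β * ((1 - δ) * boxQuadForm H a - δ * ∑ e, ‖a e‖ ^ 2))) := by
        rw [integral_const_mul, integral_indicator (ChartGauss.measurableSet_smallField s).compl]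

/-- **DENOMINATOR (sharp)**: with the sharp sandwich at level `T`, the two-sided determinant comparison on `smallField T`, the RELATIVE sandwich
`|W + Φ − Q| ≤ ε·Q` (`ε ≤ 1`, only for integrability), `0 < r`, `0 ≤ t ≤ min(T, r, 1)`, `K > 0`:
`K⁻¹·D₀·((2π²)⁻¹)^n·e^{−n(t²/3+t⁴)} · ∫_{smallField t} e^{−β((1+δ)Q + δN)} ≤ ∫_{smallField t} w`. -/
theorem le_setIntegral_smallField_sharp (hH : 1 ≤ H) {β r t T δ ε K D₀ : ℝ} (hβ : 0 < β) (hr : 0 < r) (ht0 : 0 ≤ t) (htr : t ≤ r)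
    (ht1 : t ≤ 1) (htT : t ≤ T) (hδ0 : 0 ≤ δ) (hε1 : ε ≤ 1) (hK : 0 < K) (hD₀ : 0 ≤ D₀)
    (hsand : ∀ a : LandauFree H → E3, (∀ e, ‖a e‖ ≤ T) →
      |boxWilson H (edgeChart H a) + landauPhi H (edgeChart H a) - boxQuadForm H a| ≤ δ * (boxQuadForm H a + ∑ e, ‖a e‖ ^ 2))
    (hsandRel : ∀ a : LandauFree H → E3, (∀ e, ‖a e‖ ≤ T) →
      |boxWilson H (edgeChart H a) + landauPhi H (edgeChart H a) - boxQuadForm H a| ≤ ε * boxQuadForm H a)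
    (hdet : ∀ a : LandauFree H → E3, a ∈ smallField H T →
      |(fpOperator H (edgeChart H a)).det| ≤ K * D₀ ∧ D₀ ≤ K * |(fpOperator H (edgeChart H a)).det|) :
    K⁻¹ * D₀ * ((1 / (2 * Real.pi ^ 2)) ^ Fintype.card (LandauFree H) * Real.exp (-(Fintype.card (LandauFree H) * (t ^ 2 / 3 + t ^ 4)))) *
        ∫ a in smallField H t, Real.exp (-(β * ((1 + δ) * boxQuadForm H a + δ * ∑ e, ‖a e‖ ^ 2))) ≤
      ∫ a in smallField H t, fpChartWeight β H r a := by
  have hup : ∀ a : LandauFree H → E3, a ∈ smallField H t →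
      boxWilson H (edgeChart H a) + landauPhi H (edgeChart H a) ≤ (1 + δ) * boxQuadForm H a + δ * ∑ e, ‖a e‖ ^ 2 := by
    intro a ha
    have h := (abs_le.1 (hsand a fun e => (ha e).trans htT)).2
    linarith
  set c : ℝ := K⁻¹ * D₀ * ((1 / (2 * Real.pi ^ 2)) ^ Fintype.card (LandauFree H) *
    Real.exp (-(Fintype.card (LandauFree H) * (t ^ 2 / 3 + t ^ 4)))) with hc
  have hc0 : 0 ≤ c := by rw [hc]; positivity
  have hptw : ∀ a ∈ smallField H t, c * Real.exp (-(β * ((1 + δ) * boxQuadForm H a + δ * ∑ e, ‖a e‖ ^ 2))) ≤ fpChartWeight β H r a := by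
    intro a ha
    have haT : a ∈ smallField H T := fun e => (ha e).trans htT
    have hD : K⁻¹ * D₀ ≤ |(fpOperator H (edgeChart H a)).det| := by
      rw [inv_mul_le_iff₀ hK]
      exact (hdet a haT).2
    have h := le_fpChartWeight_of_upper hβ.le hr.ne' ht0 htr ht1 hup ha
    refine le_trans ?_ h
    rw [hc]
    have hh : 0 ≤ (1 / (2 * Real.pi ^ 2)) ^ Fintype.card (LandauFree H) * Real.exp (-(Fintype.card (LandauFree H) * (t ^ 2 / 3 + t ^ 4))) := by
      positivity
    exact mul_le_mul_of_nonneg_right (mul_le_mul_of_nonneg_right hD hh) (Real.exp_pos _).le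
  have hgi := integrable_exp_twoFormPlus (H := H) hβ hδ0
  have hwi : IntegrableOn (fpChartWeight β H r) (smallField H t) :=
    integrableOn_fpChartWeight_smallField hH hβ.le hε1 hK.le hD₀ hsandRel (fun a ha => (hdet a ha).1) r ht0 htT
  calc c * ∫ a in smallField H t, Real.exp (-(β * ((1 + δ) * boxQuadForm H a + δ * ∑ e, ‖a e‖ ^ 2)))
      = ∫ a in smallField H t, c * Real.exp (-(β * ((1 + δ) * boxQuadForm H a + δ * ∑ e, ‖a e‖ ^ 2))) := (integral_const_mul _ _).symm
    _ ≤ ∫ a in smallField H t, fpChartWeight β H r a :=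
        setIntegral_mono_on (hgi.integrableOn.const_mul c) hwi (ChartGauss.measurableSet_smallField t) hptw

end SmallFieldFPSharp

end Summit.QuantumFields.YangMills.Theorems.AllWindowsColdBoxBoxHighLine
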